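import Literature.Topology.FourManifolds.IntersectionFormRealPositive
import Literature.AlgebraicTopology.SingularHomology.CupProductProofs
import HarnessLib

/-!
# A non-zero real middle class gives `b⁺ ≥ 1` for one of the two orientations

For a closed connected topological manifold `X` of dimension `n = k + k` with `k` even and a
homological `ℤ`-orientation `μ`, the real cup pairing `(y, y') ↦ ⟨y ∪ y', [X]⟩` on `Hᵏ(X; ℝ)` is
symmetric (graded commutativity, Hatcher (2002), Thm. 3.11) and perfect (Poincaré duality over
`ℝ`, Prop. 3.38). A non-zero symmetric perfect form takes a non-zero value `⟨y ∪ y, [X]⟩` on some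
diagonal vector (polarisation), positive for one of the two orientations `±μ`; by
`one_le_sigPos_intersectionForm_of_real` (`IntersectionFormRealPositive.lean`) that orientation
has `b⁺ ≥ 1`:

* `fundamentalClass_ne_zero_of_nontrivial` — `[X]_μ ≠ 0` over any non-trivial ring;
* `exists_cupPairing_self_ne_zero_of_field` — for `k` even and `Hᵏ(X; K) ≠ 0` (`K` a field of
  characteristic `≠ 2`, here any field with `(2 : K) ≠ 0`), some `y` has `⟨y ∪ y, [X]_K⟩ ≠ 0`;
* `exists_orientation_one_le_sigPos_of_ne_zero` — **if `Hᵏ(X; ℝ) ≠ 0` then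
  `1 ≤ sigPos Q_{X, μ'}` for `μ' = μ` or `μ' = -μ`** (Milnor–Husemoller (1973), §II.2: a
  unimodular symmetric lattice of positive rank is not totally isotropic, so `b⁺ + b⁻ ≥ 1`).

Used for conjunct (i) (`∃ μ, b⁺ ≥ 1`) of
`Literature.Geometry.Symplectic.canonicalClass_sq_and_adjunction_of_symplectic_four`, where
`H²(N; ℝ) ∋ [ω] ≠ 0`. Everything is proved; no definitions, no named facts.

## References

* J. Milnor, D. Husemoller, *Symmetric Bilinear Forms*, Springer (1973), §II.2. [MilnorHusemoller1973]
* A. Hatcher, *Algebraic Topology*, CUP (2002), §3.2 Thm. 3.11; §3.3 Thm. 3.26, Prop. 3.38.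
  [HatcherAT2002]
-/

noncomputable section

open Set Function Module
open Literature.AlgebraicTopology.SingularHomology Literature.Geometry.Manifold

namespace Literature.Topology.FourManifolds

variable {X : Type} [TopologicalSpace X] [T2Space X] [CompactSpace X] {k n : ℕ}
  [ChartedSpace (EuclideanSpace ℝ (Fin n)) X]

/-- The fundamental class of a closed non-empty `R`-oriented manifold is non-zero over a
non-trivial ring (it restricts to the generator `μₓ`, which corresponds to `1 ≠ 0`;
Hatcher (2002), Thm. 3.26(a)). [cite: HatcherAT2002, §3.3 Thm. 3.26(a)] -/
theorem fundamentalClass_ne_zero_of_nontrivial {R : Type} [CommRing R] [Nontrivial R] [Nonempty X]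
    (μ : HomologicalOrientation R X n) : μ.fundamentalClass ≠ 0 := by
  obtain ⟨x⟩ := (inferInstance : Nonempty X)
  intro h0
  have h1 := HomologicalOrientation.isFundamentalClass_fundamentalClass_holds (R := R) (X := X) n μ x
  rw [h0, map_zero] at h1
  obtain ⟨e, he⟩ := μ.isGenerator x
  rw [← h1, map_zero] at he
  exact zero_ne_one he

/-- **A non-zero even-degree middle cohomology over a field has a class of non-zero cup square**:
for a closed `K`-oriented manifold of dimension `k + k`, `k` even, `(2 : K) ≠ 0`, if
`Hᵏ(X; K) ≠ 0` then `⟨y ∪ y, [X]⟩ ≠ 0` for some `y` — the cup pairing is symmetric (graded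
commutativity, Hatcher Thm. 3.11, `cupProduct_gradedComm_holds`) and perfect (Prop. 3.38,
`isPerfPair_cupPairing_of_field_holds`), and a symmetric form vanishing on the diagonal vanishes
identically (polarisation). [cite: HatcherAT2002, §3.2 Thm. 3.11 and §3.3 Prop. 3.38] -/
theorem exists_cupPairing_self_ne_zero_of_field {K : Type} [Field K] (h2 : (2 : K) ≠ 0)
    (hk : Even k) (μ : HomologicalOrientation K X n) (h : k + k = n)
    {y₀ : singularCohomology K K X k} (hy₀ : y₀ ≠ 0) :
    ∃ y : singularCohomology K K X k, cupPairing μ h y y ≠ 0 := by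
  by_contra hall
  simp only [not_exists, not_not] at hall
  have hP : (cupPairing μ h).IsPerfPair := isPerfPair_cupPairing_of_field_holds
  -- symmetry
  have hsymm : ∀ a b, cupPairing μ h a b = cupPairing μ h b a := by
    intro a b
    have hf := cupPairing_flip (cupProduct_gradedComm_holds K X) μ h h
    rw [Even.neg_one_pow (hk.mul_right k), one_smul] at hf
    have := LinearMap.congr_fun (LinearMap.congr_fun hf b) a
    rwa [LinearMap.flip_apply] at this
  -- polarisation: the pairing vanishes identically
  have hzero : ∀ a b, cupPairing μ h a b = 0 := by
    intro a b
    have hab := hall (a + b)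
    simp only [map_add, LinearMap.add_apply, hall a, hall b, hsymm b a, zero_add, add_zero] at hab
    have h2ab : (2 : K) * cupPairing μ h a b = 0 := by rw [two_mul]; exact hab
    exact (mul_eq_zero.1 h2ab).resolve_left h2
  have hy : cupPairing μ h y₀ = 0 := LinearMap.ext fun b ↦ by rw [hzero, LinearMap.zero_apply]
  exact hy₀ (hP.bijective_left.1 (hy.trans (map_zero _).symm))

variable [ConnectedSpace X]

/-- **A non-zero real middle class gives `b⁺ ≥ 1` for one of the two orientations.** For a closed
connected topological manifold of dimension `k + k`, `k` even, with a `ℤ`-orientation `μ`: if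
`Hᵏ(X; ℝ) ≠ 0` then `1 ≤ sigPos Q_{X, μ'}` for some `ℤ`-orientation `μ'` (`= ±μ`). Proof: by
`exists_cupPairing_self_ne_zero_of_field` for the `ℝ`-orientation `μ ⊗ 1`, some `y` has
`⟨y ∪ y, [X]_{μ ⊗ 1}⟩ ≠ 0`; `[X]_{μ ⊗ 1}` is a (non-zero) multiple of `[X]_μ ⊗ 1` (both span the
line `Hₙ(X; ℝ)`), so `⟨y ∪ y, [X]_μ ⊗ 1⟩ ≠ 0`, positive for `μ` or for `-μ` (`[X]_{-μ} = -[X]_μ`);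
conclude by `one_le_sigPos_intersectionForm_of_real`. Milnor–Husemoller (1973), §II.2 (a
unimodular lattice of positive rank has `b⁺ + b⁻ = rank ≥ 1`). [cite: MilnorHusemoller1973, §II.2] -/
theorem exists_orientation_one_le_sigPos_of_ne_zero (hk : Even k) (μ : HomologicalOrientation ℤ X n)
    (h : k + k = n) {y₀ : singularCohomology ℝ ℝ X k} (hy₀ : y₀ ≠ 0) :
    ∃ μ' : HomologicalOrientation ℤ X n, 1 ≤ sigPos (intersectionForm h μ').toQuadraticMap := by
  set μR : HomologicalOrientation ℝ X n := μ.toCoeff ℝ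
  obtain ⟨y, hy⟩ := exists_cupPairing_self_ne_zero_of_field (K := ℝ) two_ne_zero hk μR h hy₀
  rw [cupPairing_apply] at hy
  -- `[X]_{μ ⊗ 1} = r • ([X]_μ ⊗ 1)`
  obtain ⟨r, hr⟩ := exists_eq_smul_coeffChange_fundamentalClass ℝ μ μR.fundamentalClass
  rw [hr, map_smul, smul_eq_mul] at hy
  have hne : kroneckerPairing ℝ ℝ X n (cupProduct h y y)
      (singularHomology.coeffChange X (algebraMap ℤ ℝ : ℤ →+* ℝ).toAddMonoidHom n μ.fundamentalClass) ≠ 0 :=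
    fun h0 ↦ hy (by rw [h0, mul_zero])
  rcases lt_or_gt_of_ne hne with hneg | hpos
  · refine ⟨-μ, one_le_sigPos_intersectionForm_of_real (-μ) h (y := y) ?_⟩
    rw [HomologicalOrientation.fundamentalClass_neg_holds (R := ℤ) (X := X) n μ, map_neg, map_neg]
    exact neg_pos.2 hneg
  · exact ⟨μ, one_le_sigPos_intersectionForm_of_real μ h hpos⟩

end Literature.Topology.FourManifolds
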